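import Literature.NumberTheory.Transcendental.LinGroupAuxiliaryFunction
import Literature.NumberTheory.Transcendental.LinGroupZEMain
import Literature.Barriers.Schanuel.AlgebraicIndependenceOfLogarithmsRoyThm1Assembly
import HarnessLib

/-!
# Barrier (Schanuel): Roy 1992, Theorem 1 — the discharge `roy1992_thm1_holds`

Companion (everything proved; no definitions, no named facts) of the named fact
`Literature.Barriers.Schanuel.roy1992_thm1`
(`Literature.Barriers.Schanuel.AlgebraicIndependenceOfLogarithmsRoyThm12`; [Roy1992, §1 Thm 1] =
[Waldschmidt1988, Thm 4.1], the Linear Subgroup Theorem for the linear group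
`𝔾ₐ^{d₀} × 𝔾ₘ^{d₁}`), which cannot live in that file (it is imported by the whole Roy chain).
It closes the chain

* Roy's dictionary and reductions: `roy1992_thm1_of_weak`,
  `roy1992_thm1_weak_of_linearSubgroupTheorem_weak` (`…RoyThm1FromLST.lean`);
* the §7 assembly of [Waldschmidt1988]: `Roy1992.weakLinearSubgroup_of_zeroEstimate_of_auxiliary`
  (`…RoyThm1Assembly.lean`, from `LinGroup.weakObstruction_of_zeroEstimate_of_auxiliary`);
* the auxiliary function of [Waldschmidt1988, Prop. 6.1]: `LinGroup.auxiliaryFunction`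
  (`LinGroupAuxiliaryFunction.lean`), put in Roy's setting by `Roy1992.auxiliary_hAF` below;
* Philippon's zero estimate with multiplicities on `𝔾ₐ^{d₀} × 𝔾ₘ^{d₁}` ([Philippon1986, Thm 2.1];
  [Waldschmidt1988, Prop. 7.1]): `LinGroup.zeroEstimate` (`LinGroupZEMain.lean`, the port of the
  tree's `d₀ = 1` chain `PhilipponZeroEstimate*.lean` to the index `Fin d₀ ⊕ Fin d₁`);

into `roy1992_thm1_of_zeroEstimate` (the theorem from the zero estimate as an explicit
hypothesis) and **`roy1992_thm1_holds : roy1992_thm1`**.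

## References

* [Roy1992] D. Roy, *Matrices whose coefficients are linear forms in logarithms*, J. Number
  Theory 41 (1992) 22–47, §1 Theorem 1 (p. 25).
* [Waldschmidt1988] M. Waldschmidt, *On the transcendence methods of Gel'fond and Schneider in
  several variables*, New Advances in Transcendence Theory (A. Baker ed.), CUP 1988, 375–398,
  Thm 4.1, §§6–7 (pp. 382–390).
* [Philippon1986] P. Philippon, *Lemmes de zéros dans les groupes algébriques commutatifs*,
  Bull. Soc. Math. France 114 (1986) 355–383, Thm 2.1.
-/

noncomputable section


namespace Literature.Barriers.Schanuel

open Module Submodule Complex Literature.NumberTheory.Transcendental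
  Literature.NumberTheory.Transcendental.LinGroup

/-- **The hypothesis `hAF` of `Roy1992.weakLinearSubgroup_of_zeroEstimate_of_auxiliary` holds**:
for `Y ⊆ ℚ̄^{d₀} × L^{d₁}`, `W` rational over `ℚ̄`, `Y ⊆ V`, `W ⊆ V ≠ K^{d₀} × K^{d₁}` and any
family `y` spanning `Y` over `ℚ`, the auxiliary function of [Waldschmidt1988, Prop. 6.1]
(`LinGroup.auxiliaryFunction`) exists: the coordinates `y_{j,0,i}` are algebraic and the
`e^{y_{j,1,l}}` are algebraic (`IsQbarLogSubspace`), `dim V < d₀ + d₁`, and `W` is spanned by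
finitely many of its `ℚ̄`-points (`IsQbarRational` + `exists_linearIndependent`).
[cite: Waldschmidt1988, §6 Proposition 6.1 (p. 389)] [cite: Roy1992, §1 Theorem 1 (p. 25)] -/
theorem Roy1992.auxiliary_hAF {d₀ d₁ : ℕ} (Y : Submodule ℚ (LinTangent d₀ d₁))
    (W V : Submodule ℂ (LinTangent d₀ d₁)) (hlog : IsQbarLogSubspace Y) (hrat : IsQbarRational W)
    (hYV : Y ≤ V.restrictScalars ℚ) (hWV : W ≤ V) (hV : V ≠ ⊤)
    {m : ℕ} (y : Fin m → LinTangent d₀ d₁) (hyY : Submodule.span ℚ (Set.range y) = Y) :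
    ∃ (C : ℝ) (S₀ : ℕ), 1 ≤ C ∧ ∀ S : ℕ, S₀ ≤ S →
      ∃ (P : MvPolynomial (Fin d₀ ⊕ Fin d₁) ℂ) (T : ℕ), P ≠ 0 ∧
        auxDelta C d₀ d₁ (finrank ℂ V) S / Real.log S ≤ T ∧
        (degX P : ℝ) ≤ auxDelta C d₀ d₁ (finrank ℂ V) S / Real.log S ^ 2 ∧
        (degY P : ℝ) ≤ auxDelta C d₀ d₁ (finrank ℂ V) S / S ∧
        ∀ h : Fin m → ℕ, (∀ j, h j ≤ S) →
          VanishesToOrder P W (LinGroup.exp (latt y fun j => (h j : ℤ))) T := by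
  have hyYmem : ∀ j, y j ∈ Y := fun j => hyY ▸ Submodule.subset_span ⟨j, rfl⟩
  have hyV : ∀ j, y j ∈ V := fun j => hYV (hyYmem j)
  have hn : finrank ℂ V < d₀ + d₁ := by
    have hle : finrank ℂ V ≤ d₀ + d₁ := by
      rw [← finrank_linTangent d₀ d₁]
      exact Submodule.finrank_le _
    refine lt_of_le_of_ne hle fun heq => hV ?_
    exact Submodule.eq_top_of_finrank_eq (by rw [finrank_linTangent]; exact heq)
  have halg₀ : ∀ j i, IsAlgebraic ℚ ((y j).1 i) := fun j i =>
    mem_algebraicClosure_iff.mp ((hlog (y j) (hyYmem j)).1 i)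
  have halg₁ : ∀ j l, IsAlgebraic ℚ (cexp ((y j).2 l)) := fun j l => (hlog (y j) (hyYmem j)).2 l
  -- a finite family of `ℚ̄`-points spanning `W`
  obtain ⟨t, w, hwW, hWspan, hwalg₀, hwalg₁⟩ : ∃ (t : ℕ) (w : Fin t → LinTangent d₀ d₁),
      (∀ k, w k ∈ W) ∧ W ≤ Submodule.span ℂ (Set.range w) ∧
      (∀ k i, IsAlgebraic ℚ ((w k).1 i)) ∧ ∀ k l, IsAlgebraic ℚ ((w k).2 l) := by
    obtain ⟨b, hbS, hbspan, hbli⟩ :=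
      exists_linearIndependent ℂ {v : LinTangent d₀ d₁ | v ∈ W ∧ IsQbarPoint v}
    have hbfin : b.Finite := Set.finite_coe_iff.mp hbli.finite
    obtain ⟨t, f, hf⟩ := hbfin.fin_embedding
    have hmem : ∀ k, (f k : LinTangent d₀ d₁) ∈ b := fun k => hf ▸ ⟨k, rfl⟩
    refine ⟨t, fun k => f k, fun k => (hbS (hmem k)).1, ?_, fun k i =>
      mem_algebraicClosure_iff.mp ((hbS (hmem k)).2.1 i), fun k l =>
      mem_algebraicClosure_iff.mp ((hbS (hmem k)).2.2 l)⟩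
    have hrange : Set.range (fun k => (f k : LinTangent d₀ d₁)) = b := hf
    rw [hrange, hbspan]
    exact hrat.le
  exact auxiliaryFunction y W V hyV hWV hn halg₀ halg₁ w hwW hWspan hwalg₀ hwalg₁

/-- **Roy 1992, Theorem 1, closed modulo the zero estimate.** `roy1992_thm1`
(= [Waldschmidt1988, Thm 4.1] for `𝔾ₐ^{d₀} × 𝔾ₘ^{d₁}`) follows from Philippon's zero estimate with
multiplicities on `𝔾ₐ^{d₀} × 𝔾ₘ^{d₁}` in the shape `hZE` of
`LinGroup.weakObstruction_of_zeroEstimate_of_auxiliary` ([Philippon1986, Thm 2.1] for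
`G ⊂ (ℙ¹)^{d₀+d₁}`, multidegrees `(D₀, …, D₀, D₁, …, D₁)`), everything else being proved:
Roy's dictionary and reductions (`roy1992_thm1_of_weak`,
`roy1992_thm1_weak_of_linearSubgroupTheorem_weak`), the §7 assembly
(`Roy1992.weakLinearSubgroup_of_zeroEstimate_of_auxiliary`) and the auxiliary function
(`Roy1992.auxiliary_hAF`). [cite: Roy1992, §1 Theorem 1 (p. 25)]
[cite: Waldschmidt1988, §4 Theorem 4.1, §§6–7 (pp. 382–390)] -/
theorem roy1992_thm1_of_zeroEstimate
    (hZE : ∀ d₀ d₁ : ℕ, ∃ c : ℕ, ∀ (D₀ D₁ T : ℕ) (W : Submodule ℂ (LinTangent d₀ d₁))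
        (S : Set (LinGroup d₀ d₁)) (P : MvPolynomial (Fin d₀ ⊕ Fin d₁) ℂ),
      1 ≤ D₀ → 1 ≤ D₁ → 0 < finrank ℂ W → S.Finite → (1 : LinGroup d₀ d₁) ∈ S → P ≠ 0 →
      degX P ≤ D₀ → degY P ≤ D₁ →
      (∀ g ∈ sumset S (d₀ + d₁), VanishesToOrder P W g ((d₀ + d₁) * T + 1)) →
      ∃ H : ConnAlgSubgroup d₀ d₁,
        (∃ g : LinGroup d₀ d₁, ∀ h ∈ H.toSubgroup, evalAt P (g * h) = 0) ∧
        Nat.choose (T + (finrank ℂ W - finrank ℂ ↥(W ⊓ H.tangent)))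
            (finrank ℂ W - finrank ℂ ↥(W ⊓ H.tangent)) *
          Set.ncard ((QuotientGroup.mk : LinGroup d₀ d₁ → LinGroup d₀ d₁ ⧸ H.toSubgroup) '' S) *
          D₀ ^ H.addDim * D₁ ^ H.torusDim ≤ c * D₀ ^ d₀ * D₁ ^ d₁) :
    roy1992_thm1 :=
  roy1992_thm1_of_weak (roy1992_thm1_weak_of_linearSubgroupTheorem_weak
    fun d₀ d₁ Y W V hfin hlog hrat hYV hWV hV => by
      obtain ⟨c, hc⟩ := hZE d₀ d₁
      exact Roy1992.weakLinearSubgroup_of_zeroEstimate_of_auxiliary c hc Y W V hfin hV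
        fun y _ hyY => Roy1992.auxiliary_hAF Y W V hlog hrat hYV hWV hV y hyY)

/-- **Roy 1992, Theorem 1** (= [Waldschmidt1988, Thm 4.1], the Linear Subgroup Theorem for
`𝔾ₐ^{d₀} × 𝔾ₘ^{d₁}`, `K = ℂ`): the named fact `roy1992_thm1` HOLDS — Roy's reductions, the §7
assembly and the auxiliary function of [Waldschmidt1988], and Philippon's zero estimate with
multiplicities (`LinGroup.zeroEstimate`), all proved in the tree.
[cite: Roy1992, §1 Theorem 1 (p. 25)] [cite: Waldschmidt1988, §4 Theorem 4.1 (pp. 382–383), §§6–7 (pp. 389–390)]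
[cite: Philippon1986, Thm 2.1] -/
theorem roy1992_thm1_holds : roy1992_thm1 :=
  roy1992_thm1_of_zeroEstimate fun d₀ d₁ => LinGroup.zeroEstimate d₀ d₁

end Literature.Barriers.Schanuel
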